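import Literature.MathematicalPhysics.PowerSystems.DVOCReducedNetworkLyapunov
import Summits.Ventures.GridStability.Lyapunov.LocalSyncSpectrum
import HarnessLib

/-!
# GridStability/Lyapunov/LocalSyncForm — the local synchronisation form `Q(α) + 𝒥_σ` of the reduced dVOC network (G2-SCALE T-row T7b;
idea-2 cycle-2 card «local-sync-form-edge-gain-certificate» D1 + P3 + REV-3 covering gains; lead §45 D65, crit-1 «TYPED LITERALLY ✓» 2026-08-28T20:21Z; seat gridfusion-sos-5 g10)

For `W : DvocReduced N` (reduced dVOC network in phase-error form, `Literature/…/DVOCReducedNetworkLyapunov.lean`) with edge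
weights `w`, magnitudes `r = vref`, angles `θ`: synchronising stiffness `S_ij = w_ij r_i r_j cos(θ_j − θ_i)`, transit
`s̃_ij = w_ij r_i r_j sin(θ_j − θ_i) = −s̃_ji`, injection `σ_i = Σ_j s̃_ij`, `L_S = Σ S_e (e_i − e_j)(e_i − e_j)ᵀ`, `A = (s̃_ij)`,
`D = diag r²`; the LOCAL SYNCHRONISATION FORM `Q(α) = [[L_S + 2αD, A], [Aᵀ, L_S]]` (symmetric when `w` is), the injection-
GYROSCOPIC form `𝒥_σ = [[0, −diag σ], [diag σ, 0]]` (skew), `D̂ = D ⊕ D`, and the two structural modes (P3):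
`(Q + 𝒥_σ)(0, 𝟙) = 0` (rotation) and `(Q + 𝒥_σ)(𝟙, 0) = 2α·D̂(𝟙, 0)` (uniform amplitude). The claim that
`−η D̂⁻¹(Q(α) + 𝒥_σ)` is the Jacobian of `W.field` at `v*_k = r_k∠θ_k` in co-rotating polar coordinates is NOT typed here
(card K3, a named hypothesis H_JAC of any instance; validated numerically to 1e-9 in HOME/cert/sos-5/localsync/jac_check.py).
THREE COLUMNS: definitions + algebra about MATRICES built from the model's parameters; MODELLED = model M of GrossEtAl2019 (17);
nothing here says a converter or a grid is stable.
-/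

noncomputable section

open Matrix Finset Real

namespace Summit.Ventures.GridStability.Lyapunov

open Literature.MathematicalPhysics.PowerSystems

namespace LocalSync

variable {N : ℕ} (W : DvocReduced N)

/-- Synchronising stiffness of the ordered pair `(i, j)`: `S_ij = w_ij r_i r_j cos(θ_j − θ_i)`. [folklore] -/
def stiff (i j : Fin N) : ℝ := W.w i j * W.vref i * W.vref j * cos (W.θ j - W.θ i)

/-- Transit coupling `s̃_ij = w_ij r_i r_j sin(θ_j − θ_i)` (antisymmetric for symmetric `w`). [folklore] -/
def transit (i j : Fin N) : ℝ := W.w i j * W.vref i * W.vref j * sin (W.θ j - W.θ i)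

/-- Injection `σ_i = Σ_j s̃_ij`. [folklore] -/
def sigma (i : Fin N) : ℝ := ∑ j, transit W i j

/-- The stiffness Laplacian `L_S`: diagonal `Σ_j S_ij`, off-diagonal `−S_ij` (row sums zero). [folklore] -/
def LS : Matrix (Fin N) (Fin N) ℝ :=
  Matrix.of fun i j => (if i = j then ∑ k, stiff W i k else 0) - stiff W i j

/-- The transit matrix `A = (s̃_ij)`. [folklore] -/
def Amat : Matrix (Fin N) (Fin N) ℝ := Matrix.of fun i j => transit W i j

/-- `D = diag(r_k²)`. [folklore] -/
def Dmat : Matrix (Fin N) (Fin N) ℝ := Matrix.diagonal fun k => W.vref k ^ 2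

/-- The LOCAL SYNCHRONISATION FORM `Q(α) = [[L_S + 2α·D, A], [Aᵀ, L_S]]` on `ℝ^N × ℝ^N` (amplitude block first).
[folklore] -/
def Qform : Matrix (Fin N ⊕ Fin N) (Fin N ⊕ Fin N) ℝ :=
  Matrix.fromBlocks (LS W + (2 * W.α) • Dmat W) (Amat W) (Amat W)ᵀ (LS W)

/-- The injection-GYROSCOPIC form `𝒥_σ = [[0, −diag σ], [diag σ, 0]]`. [folklore] -/
def gyro : Matrix (Fin N ⊕ Fin N) (Fin N ⊕ Fin N) ℝ :=
  Matrix.fromBlocks 0 (-Matrix.diagonal (sigma W)) (Matrix.diagonal (sigma W)) 0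

/-- `D̂ = D ⊕ D`. [folklore] -/
def Dhat : Matrix (Fin N ⊕ Fin N) (Fin N ⊕ Fin N) ℝ := Matrix.fromBlocks (Dmat W) 0 0 (Dmat W)

/-- The rotation mode `ρ = (0, 𝟙)` on `ℝ^N × ℝ^N`. [folklore] -/
def rot (N : ℕ) : Fin N ⊕ Fin N → ℝ := Sum.elim (0 : Fin N → ℝ) (1 : Fin N → ℝ)

/-- The uniform-amplitude mode `(𝟙, 0)` on `ℝ^N × ℝ^N`. [folklore] -/
def amp (N : ℕ) : Fin N ⊕ Fin N → ℝ := Sum.elim (1 : Fin N → ℝ) (0 : Fin N → ℝ)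

/-- `𝒥_σ` is skew. [folklore] -/
theorem gyro_transpose : (gyro W)ᵀ = -gyro W := by
  rw [gyro, Matrix.fromBlocks_transpose, Matrix.fromBlocks_neg]
  simp [Matrix.diagonal_transpose]

/-- `D̂ρ = (0, r²)`. [folklore] -/
theorem Dhat_mulVec_rot : Dhat W *ᵥ rot N = Sum.elim (0 : Fin N → ℝ) (fun k => W.vref k ^ 2) := by
  rw [Dhat, rot, Matrix.fromBlocks_mulVec]
  funext x
  rcases x with i | j <;> simp [Dmat, Matrix.mulVec_diagonal]

/-- `D̂ ≻ 0` when every `r_k ≠ 0`. [folklore] -/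
theorem Dhat_posDef (hr : ∀ k, W.vref k ≠ 0) : (Dhat W).PosDef := by
  rw [Dhat, Dmat, Matrix.fromBlocks_diagonal]
  refine Matrix.PosDef.diagonal fun x => ?_
  have hsq : ∀ k, 0 < W.vref k ^ 2 := fun k => by have h := hr k; positivity
  rcases x with k | k
  · simpa using hsq k
  · simpa using hsq k

/-- Row sums of `L_S` vanish: `L_S 𝟙 = 0`. [folklore] -/
theorem LS_mulVec_one : LS W *ᵥ 1 = 0 := by
  funext i
  simp only [LS, Matrix.mulVec, dotProduct, Matrix.of_apply, Pi.one_apply, mul_one, Pi.zero_apply,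
    Finset.sum_sub_distrib, Finset.sum_ite_eq, Finset.mem_univ, if_true, sub_self]

/-- For symmetric weights the transit coupling is antisymmetric: `s̃_ji = −s̃_ij`. [folklore] -/
theorem transit_swap (hw : ∀ i j, W.w i j = W.w j i) (i j : Fin N) : transit W j i = -transit W i j := by
  simp only [transit, hw j i]
  rw [show W.θ i - W.θ j = -(W.θ j - W.θ i) by ring, Real.sin_neg]
  ring

/-- `A 𝟙 = σ`. [folklore] -/
theorem Amat_mulVec_one : Amat W *ᵥ 1 = sigma W := by
  funext i
  simp [Amat, sigma, Matrix.mulVec, dotProduct]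

/-- `Aᵀ 𝟙 = −σ` for symmetric weights. [folklore] -/
theorem Amat_transpose_mulVec_one (hw : ∀ i j, W.w i j = W.w j i) : (Amat W)ᵀ *ᵥ 1 = -sigma W := by
  funext j
  simp only [Amat, sigma, Matrix.mulVec, dotProduct, Matrix.transpose_apply, Matrix.of_apply, Pi.one_apply,
    mul_one, Pi.neg_apply, ← Finset.sum_neg_distrib]
  exact Finset.sum_congr rfl fun i _ => by rw [transit_swap W hw j i]

/-- **P3 (rotation mode):** `(Q(α) + 𝒥_σ) ρ = 0`, `ρ = (0, 𝟙)`. [folklore] -/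
theorem form_mulVec_rot : (Qform W + gyro W) *ᵥ rot N = 0 := by
  rw [Matrix.add_mulVec, Qform, gyro, rot, Matrix.fromBlocks_mulVec, Matrix.fromBlocks_mulVec]
  simp only [Sum.elim_comp_inl, Sum.elim_comp_inr, Matrix.mulVec_zero, zero_add, Matrix.zero_mulVec, add_zero,
    LS_mulVec_one, Amat_mulVec_one, Matrix.neg_mulVec]
  funext x
  rcases x with i | j <;> simp [Matrix.mulVec_diagonal]

/-- **P3 (uniform-amplitude mode):** `(Q(α) + 𝒥_σ)(𝟙, 0) = 2α·D̂(𝟙, 0)` for symmetric weights. [folklore] -/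
theorem form_mulVec_amp (hw : ∀ i j, W.w i j = W.w j i) :
    (Qform W + gyro W) *ᵥ amp N = (2 * W.α) • (Dhat W *ᵥ amp N) := by
  rw [Matrix.add_mulVec, Qform, gyro, amp, Dhat, Matrix.fromBlocks_mulVec, Matrix.fromBlocks_mulVec,
    Matrix.fromBlocks_mulVec]
  simp only [Sum.elim_comp_inl, Sum.elim_comp_inr, Matrix.mulVec_zero, add_zero, zero_add, Matrix.zero_mulVec,
    Matrix.add_mulVec, LS_mulVec_one, Amat_transpose_mulVec_one W hw, Matrix.smul_mulVec]
  funext x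
  rcases x with i | j <;> simp [Dmat, Matrix.mulVec_diagonal]

/-- `Q(α)` is MONOTONE in the gain: `Q(α) = Q(α₀) + 2(α − α₀)·(D ⊕ 0)`, so its quadratic form only grows with `α`.
Stated for two parameter records that differ only in `α`. [folklore] -/
theorem Qform_quadForm_mono (W₀ W₁ : DvocReduced N) (hη : W₁.vref = W₀.vref) (hθ : W₁.θ = W₀.θ) (hw : W₁.w = W₀.w)
    (hα : W₀.α ≤ W₁.α) (u : Fin N ⊕ Fin N → ℝ) :
    u ⬝ᵥ (Qform W₀ *ᵥ u) ≤ u ⬝ᵥ (Qform W₁ *ᵥ u) := by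
  have hS : stiff W₁ = stiff W₀ := by funext i j; simp [stiff, hη, hθ, hw]
  have hT : transit W₁ = transit W₀ := by funext i j; simp [transit, hη, hθ, hw]
  have hL : LS W₁ = LS W₀ := by simp only [LS, hS]
  have hA : Amat W₁ = Amat W₀ := by simp only [Amat, hT]
  have hD : Dmat W₁ = Dmat W₀ := by simp only [Dmat, hη]
  have hdiff : Qform W₁ = Qform W₀ + Matrix.fromBlocks ((2 * (W₁.α - W₀.α)) • Dmat W₀) 0 0 0 := by
    rw [Qform, Qform, hL, hA, hD, Matrix.fromBlocks_add]
    congr 1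
    · rw [add_assoc, ← add_smul]; ring_nf
    all_goals simp
  rw [hdiff, Matrix.add_mulVec, dotProduct_add, le_add_iff_nonneg_right]
  -- the extra term is 2(α₁ − α₀) Σ r_k² u_k² ≥ 0 on the amplitude block
  set ux : Fin N → ℝ := fun k => u (Sum.inl k)
  set uy : Fin N → ℝ := fun k => u (Sum.inr k)
  have hu : u = Sum.elim ux uy := by funext x; rcases x with i | j <;> rfl
  rw [hu, Matrix.fromBlocks_mulVec, Sum.elim_comp_inl, Sum.elim_comp_inr]
  simp only [Matrix.zero_mulVec, add_zero, sumElim_dotProduct_sumElim, dotProduct_zero, Matrix.smul_mulVec,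
    dotProduct_smul, smul_eq_mul]
  have h2 : 0 ≤ 2 * (W₁.α - W₀.α) := by linarith
  refine mul_nonneg h2 ?_
  simp only [Dmat, Matrix.mulVec_diagonal, dotProduct]
  exact Finset.sum_nonneg fun k _ => by
    have : 0 ≤ W₀.vref k ^ 2 * (ux k * ux k) := mul_nonneg (sq_nonneg _) (mul_self_nonneg _)
    nlinarith [this]

/-! ## Per-bus gains (the COVERING certificate of idea-2 REV 3) -/

/-- The local synchronisation form with a PER-BUS gain vector `αv`: `[[L_S + diag(2 αv_k r_k²), A], [Aᵀ, L_S]]`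
(`Qform W = QformVec W (fun _ => W.α)`). A parameter of the MATRIX, not of the typed model. [folklore] -/
def QformVec (αv : Fin N → ℝ) : Matrix (Fin N ⊕ Fin N) (Fin N ⊕ Fin N) ℝ :=
  Matrix.fromBlocks (LS W + Matrix.diagonal fun k => 2 * αv k * W.vref k ^ 2) (Amat W) (Amat W)ᵀ (LS W)

/-- The uniform-gain form is the per-bus form at the constant vector. [folklore] -/
theorem Qform_eq_QformVec : Qform W = QformVec W (fun _ => W.α) := by
  rw [Qform, QformVec, Dmat, ← Matrix.diagonal_smul]
  congr 3

/-- `L_S` is symmetric for symmetric weights. [folklore] -/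
theorem LS_transpose (hw : ∀ i j, W.w i j = W.w j i) : (LS W)ᵀ = LS W := by
  ext i j
  simp only [LS, Matrix.transpose_apply, Matrix.of_apply]
  have hs : stiff W j i = stiff W i j := by
    simp only [stiff, hw j i]
    rw [show W.θ i - W.θ j = -(W.θ j - W.θ i) by ring, Real.cos_neg]
    ring
  by_cases h : i = j
  · subst h; rfl
  · rw [if_neg (Ne.symm h), if_neg h, hs]

/-- `QformVec` is symmetric for symmetric weights. [folklore] -/
theorem QformVec_transpose (hw : ∀ i j, W.w i j = W.w j i) (αv : Fin N → ℝ) : (QformVec W αv)ᵀ = QformVec W αv := by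
  rw [QformVec, Matrix.fromBlocks_transpose, Matrix.transpose_add, LS_transpose W hw, Matrix.diagonal_transpose,
    Matrix.transpose_transpose]

/-- **Monotonicity in the gain vector**: `αv ≤ αv'` componentwise ⇒ the form of `QformVec αv'` dominates that of `QformVec αv`
(the difference is `diag(2(αv' − αv) r²) ⊕ 0 ⪰ 0`). [folklore] -/
theorem QformVec_quadForm_mono {αv αv' : Fin N → ℝ} (h : ∀ k, αv k ≤ αv' k) (u : Fin N ⊕ Fin N → ℝ) :
    u ⬝ᵥ (QformVec W αv *ᵥ u) ≤ u ⬝ᵥ (QformVec W αv' *ᵥ u) := by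
  have hdiff : QformVec W αv' = QformVec W αv + Matrix.fromBlocks (Matrix.diagonal fun k => 2 * (αv' k - αv k) * W.vref k ^ 2) 0 0 0 := by
    rw [QformVec, QformVec, Matrix.fromBlocks_add]
    congr 1
    · rw [add_assoc, Matrix.diagonal_add]
      congr 2; ext k; ring
    all_goals simp
  rw [hdiff, Matrix.add_mulVec, dotProduct_add, le_add_iff_nonneg_right]
  set ux : Fin N → ℝ := fun k => u (Sum.inl k)
  set uy : Fin N → ℝ := fun k => u (Sum.inr k)
  have hu : u = Sum.elim ux uy := by funext x; rcases x with i | j <;> rfl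
  rw [hu, Matrix.fromBlocks_mulVec, Sum.elim_comp_inl, Sum.elim_comp_inr]
  simp only [Matrix.zero_mulVec, add_zero, sumElim_dotProduct_sumElim, dotProduct_zero]
  simp only [Matrix.mulVec_diagonal, dotProduct]
  exact Finset.sum_nonneg fun k _ => by
    have h1 : 0 ≤ αv' k - αv k := sub_nonneg.2 (h k)
    have : 0 ≤ (αv' k - αv k) * (W.vref k ^ 2 * (ux k * ux k)) :=
      mul_nonneg h1 (mul_nonneg (sq_nonneg _) (mul_self_nonneg _))
    nlinarith [this]

/-- **Positive definiteness transfers UP along forms**: `B ≻ 0`, `A` symmetric, `yᵀBy ≤ yᵀAy` for all `y` ⇒ `A ≻ 0`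
(real matrices). [folklore] -/
theorem posDef_of_quadForm_le {κ : Type*} [Fintype κ] [DecidableEq κ] {A B : Matrix κ κ ℝ} (hB : B.PosDef) (hA : Aᵀ = A)
    (h : ∀ y, y ⬝ᵥ (B *ᵥ y) ≤ y ⬝ᵥ (A *ᵥ y)) : A.PosDef := by
  refine Matrix.PosDef.of_dotProduct_mulVec_pos ?_ fun y hy => ?_
  · rw [Matrix.IsHermitian, Matrix.conjTranspose_eq_transpose_of_trivial, hA]
  · have := hB.dotProduct_mulVec_pos hy
    rw [star_trivial] at this ⊢
    exact this.trans_le (h y)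

/-- Monotonicity pushed through a reduction `Z`: `Zᵀ·QformVec αv·Z ≻ 0` and `αv ≤ αv'` ⇒ `Zᵀ·QformVec αv'·Z ≻ 0` (symmetric `w`).
[folklore] -/
theorem reduced_posDef_mono (hw : ∀ i j, W.w i j = W.w j i) {κ : Type*} [Fintype κ] [DecidableEq κ]
    (Z : Matrix (Fin N ⊕ Fin N) κ ℝ) {αv αv' : Fin N → ℝ} (h : ∀ k, αv k ≤ αv' k)
    (hPD : (Zᵀ * QformVec W αv * Z).PosDef) : (Zᵀ * QformVec W αv' * Z).PosDef := by
  refine posDef_of_quadForm_le hPD ?_ fun y => ?_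
  · rw [Matrix.transpose_mul, Matrix.transpose_mul, Matrix.transpose_transpose, QformVec_transpose W hw, Matrix.mul_assoc]
  · have e : ∀ (M : Matrix (Fin N ⊕ Fin N) (Fin N ⊕ Fin N) ℝ), y ⬝ᵥ ((Zᵀ * M * Z) *ᵥ y) = (Z *ᵥ y) ⬝ᵥ (M *ᵥ (Z *ᵥ y)) := by
      intro M
      rw [← Matrix.mulVec_mulVec, ← Matrix.mulVec_mulVec, Matrix.dotProduct_mulVec y Zᵀ, Matrix.vecMul_transpose]
    rw [e, e]
    exact QformVec_quadForm_mono W h _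

/-! ## Assembly: the local synchronisation spectrum from ONE reduced positive definite certificate -/

/-- **LOCAL SYNCHRONISATION SPECTRUM FROM A SPARSE CERTIFICATE.** For nonzero magnitudes `r_k` (no symmetry of `w` needed), `N ≥ 1`,
`η > 0`: if `Z` is any real matrix with `(D̂ρ)ᵀZ = 0` and `#cols + 1 = 2N` such that `Zᵀ Q(α) Z ≻ 0` (ONE positive definite
certificate — e.g. the tree-basis reduction `Z = I ⊕ Z_tree` of the card), then every complex eigenpair of the local
synchronisation matrix `A = −η D̂⁻¹(Q(α) + 𝒥_σ)` has `Re μ < 0`, except `μ = 0` with eigenvector in `ℂρ` (the rotation mode).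
This is a statement about the MATRIX `A` built from `W`'s parameters; that `A` is the linearisation of `W.field` at `v*` is the
named hypothesis H_JAC (card K3), and the ODE step to local exponential synchronisation is H_LIN (card K4). [folklore] -/
theorem re_eig_neg_or_zero_of_certificate [NeZero N] (hr : ∀ k, W.vref k ≠ 0)
    (hη : 0 < W.η) {κ : Type*} [Fintype κ] [DecidableEq κ] (Z : Matrix (Fin N ⊕ Fin N) κ ℝ)
    (hZ : (Dhat W *ᵥ rot N) ᵥ* Z = 0) (hcard : Fintype.card κ + 1 = Fintype.card (Fin N ⊕ Fin N))
    (hPD : (Zᵀ * Qform W * Z).PosDef)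
    {μ : ℂ} {v : Fin N ⊕ Fin N → ℂ} (hv : v ≠ 0)
    (hAv : (-(W.η • ((Dhat W)⁻¹ * (Qform W + gyro W)))).map ((↑) : ℝ → ℂ) *ᵥ v = μ • v) :
    μ.re < 0 ∨ (μ = 0 ∧ ∃ c : ℂ, v = c • fun x => (rot N x : ℂ)) := by
  have hd : Dhat W *ᵥ rot N ≠ 0 := by
    rw [Dhat_mulVec_rot]
    intro h
    have h0 := congr_fun h (Sum.inr (0 : Fin N))
    simp only [Sum.elim_inr, Pi.zero_apply] at h0
    exact (pow_ne_zero 2 (hr 0)) h0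
  exact re_eig_neg_or_zero_of_inv_mul_form (gyro_transpose W) (Dhat_posDef W hr) (form_mulVec_rot W)
    (posDefOn_of_reduced_posDef hd Z hZ hcard hPD) hη hv hAv

/-- **Assembly with a COVERING per-bus certificate**: symmetric weights, `r_k ≠ 0`, `N ≥ 1`, `η > 0`; a reduction `Z` with
`(D̂ρ)ᵀZ = 0`, `#cols + 1 = 2N`; a gain vector `αv ≤ W.α` componentwise with `Zᵀ·QformVec αv·Z ≻ 0` ⇒ the spectral conclusion for
the UNIFORM-gain matrix `−η D̂⁻¹(Qform W + 𝒥_σ)` of the typed model. [folklore] -/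
theorem re_eig_neg_or_zero_of_covering_certificate [NeZero N] (hw : ∀ i j, W.w i j = W.w j i) (hr : ∀ k, W.vref k ≠ 0)
    (hη : 0 < W.η) {κ : Type*} [Fintype κ] [DecidableEq κ] (Z : Matrix (Fin N ⊕ Fin N) κ ℝ)
    (hZ : (Dhat W *ᵥ rot N) ᵥ* Z = 0) (hcard : Fintype.card κ + 1 = Fintype.card (Fin N ⊕ Fin N))
    {αv : Fin N → ℝ} (hα : ∀ k, αv k ≤ W.α) (hPD : (Zᵀ * QformVec W αv * Z).PosDef)
    {μ : ℂ} {v : Fin N ⊕ Fin N → ℂ} (hv : v ≠ 0)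
    (hAv : (-(W.η • ((Dhat W)⁻¹ * (Qform W + gyro W)))).map ((↑) : ℝ → ℂ) *ᵥ v = μ • v) :
    μ.re < 0 ∨ (μ = 0 ∧ ∃ c : ℂ, v = c • fun x => (rot N x : ℂ)) := by
  have h1 : (Zᵀ * Qform W * Z).PosDef := by
    rw [Qform_eq_QformVec]
    exact reduced_posDef_mono W hw Z hα hPD
  exact re_eig_neg_or_zero_of_certificate W hr hη Z hZ hcard h1 hv hAv

end LocalSync

end Summit.Ventures.GridStability.Lyapunov

end
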